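import Summits.QuantumFields.QCD.Theorems.HeatSlicedQuarksRobustYangMillsHandoverStubDetDiracMatrixSourceHasDerivAtSmit
import Summits.QuantumFields.QCD.Theorems.HeatSlicedQuarksRobustYangMillsHandoverStubDiracMatrixMultiSourceTimeSlice
import Summits.QuantumFields.QCD.Theorems.HeatSlicedQuarksRobustYangMillsHandoverStubProjChainDetTwoSources
import Summits.QuantumFields.QCD.Theorems.HeatSlicedQuarksRobustYangMillsHandoverStubFermiIntegralSourcesDet
import HarnessLib

/-!
# Stub `stub_det_diracMatrix_two_sources_smit` of line `pin-the-infimum`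
(crux `RobustYangMillsHandover`, 8892)

E2 (fermionic insertions in Lüscher's transfer form), layer E2-b(2): **two sources at distinct
time slices, per background, in Smit's vocabulary, and the two-bilinear Berezin identity.**
For an `SU(3)` gauge field `U` on `(ℤ/L)⁴`, `N_f` flavours of `r = 1` Wilson quarks with masses
`mq f > −1`, slices `t₁ ≠ t₂` and source blocks `Jh₁`, `Jh₂` on the quark variables of these
slices (torus-level equal-time sources `Jt t_k Jh_k`):
(a) `∂_{s₁}|₀ ∂_{s₂}|₀ det (D(U) − s₁ Jt t₁ Jh₁ − s₂ Jt t₂ Jh₂) = STr ∏_i (𝒦¹_i 𝒦²_i · T̂_F(U_i) Γ(G_{g_i}))`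
with the link-free Fock insertions `𝒦ᵏ_{t_k} = ins (U_{t_k}) Jh_k` of the landed one-source theorem
`stub_det_diracMatrix_source_hasDerivAt_smit` (`𝒦ᵏ_i = 1` off the slice `t_k`); (b) the meson
two-point numerator `∫dψ̄dψ (ψ̄ Jt₂ ψ)(ψ̄ Jt₁ ψ) e^{−ψ̄D(U)ψ}` is `ε = (−1)^{n(n−1)/2 + n}` times the same
supertrace — Lüscher's supertrace formula with two insertions.

## Proof (assembly of landed bricks)

γ0-multi `stub_diracMatrix_multiSource_timeSlice` (`c = s₁δ_{t₁} + s₂δ_{t₂}`): the two-source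
determinant is that of the `N_f`-flavour projector chain with slice operators `A_{t_k} − s_k Jsl_k`;
F4-a `stub_projChain_det_two_sources`: the mixed derivative is `(∏ det E_t) · STr ∏_i (𝒥¹_i 𝒥²_i Γ(N_i))`;
BOTH insertions are undressed at once (`StubDetDiracMatrixTwoSourcesSmit.undress_two`: the cyclic
undressing `stub_supertrace_undress_insert` is general in the slot insertions, here `𝒥¹_i 𝒥²_i`,
conjugation distributing over the product; transporters `S̃_t = (W_tP⁺ + P⁻) · V` undress the
temporal links AND the constant spin rotation `V = 1 ⊗ γ₄γ₅` in one step), with the per-slot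
one-particle identities of F2 (`StubWilsonChainUndressInsertion.insertion_undress`,
`neg_inv_mul_eq_dressed`) and the `N_f`-flavour dictionary (`stub_flavourChain_slice_dictionary`,
`stub_flavourChain_dressedCore`); the Dirac-sea scalars `det Â_i²` are pushed onto
`T̂_F(U_i) = det Â_i² · Γ(M_F(U_i))`; (b) follows from (a) and conjunct 3 of the Berezin stub
`stub_fermiIntegral_sources_det` by uniqueness of derivatives.

Pure theorem file (no definitions).  References: M. Lüscher, Comm. Math. Phys. 54 (1977) 283–292;
J. Smit, *Introduction to Quantum Fields on a Lattice* (CUP 2002/2023), §6.5 (6.91), App. C;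
I. Montvay, G. Münster, *Quantum Fields on a Lattice* (CUP 1994), §4.1 (4.14)–(4.17), §4.2.3, §7.1.
-/

namespace Summit.QuantumFields.QCD.Cruxes.RobustYangMillsHandover.PinTheInfimum

open Literature.MathematicalPhysics.QuantumLattice Literature.MathematicalPhysics.QuantumFieldTheory
open Literature.Probability.LatticeModels (TorusSite)
open Summit.QuantumFields.QCD.Cruxes.StableActionBridge.Sketch
open Summit.QuantumFields.QCD.Cruxes.StableActionBridge.Sketch.FockLiftPosDef
open Summit.QuantumFields.QCD.Cruxes.StableActionBridge.Sketch.FermionSliceOpCovariance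

namespace StubDetDiracMatrixTwoSourcesSmit

/-- If `∂_{s₁}|₀ ∂_{s₂}|₀ f = v` and `∂_{s₁}|₀ ∂_{s₂}|₀ (ε f) = w`, then `w = ε v` (`deriv (ε g) = ε deriv g`
pointwise, uniqueness of derivatives). [folklore] -/
theorem deriv_two_unique {f : ℝ → ℝ → ℂ} {ε v w : ℂ}
    (ha : HasDerivAt (fun s₁ : ℝ => deriv (f s₁) 0) v 0)
    (hb : HasDerivAt (fun s₁ : ℝ => deriv (fun s₂ : ℝ => ε * f s₁ s₂) 0) w 0) : w = ε * v := by
  simp only [deriv_const_mul_field'] at hb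
  exact hb.unique (ha.const_mul ε)

section Undress

variable {ι m n : Type*} [LinearOrder ι] [Fintype ι] [Fintype m] [DecidableEq m] [LinearOrder n] [Fintype n]

/-- **Cyclic undressing of the supertrace with TWO slot insertions**: for invertible transporters
`S_t` and insertions `Q¹_t`, `Q²_t` with conjugates `Γ(S_{t−1})⁻¹ Qᵏ_t Γ(S_{t−1}) = Qᵏ′_t`,
`STr ∏_{i<T} Q¹_i Q²_i Γ(S_{i−1}) Xf_i Γ(S_i⁻¹) = STr ∏_{i<T} Q¹′_i Q²′_i Xf_i` — the landed
`stub_supertrace_undress_insert` with the product insertion `Q¹_i Q²_i` (`Γ(S) Γ(S⁻¹) = 1` splits the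
conjugate of the product). [cite: Luscher1977, pp. 283–292] -/
theorem supertrace_undress_insert₂ (T : ℕ) (S : ZMod T → Matrix ι ι ℂ)
    (Q₁ Q₂ Q₁' Q₂' Xf : ZMod T → Matrix (Finset ι) (Finset ι) ℂ) (hS : ∀ t, IsUnit (S t).det)
    (h₁ : ∀ t, fockLift (S (t - 1))⁻¹ * Q₁ t * fockLift (S (t - 1)) = Q₁' t)
    (h₂ : ∀ t, fockLift (S (t - 1))⁻¹ * Q₂ t * fockLift (S (t - 1)) = Q₂' t) :
    ∑ s : Finset ι, (-1 : ℂ) ^ s.card *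
        (((List.range T).map fun i : ℕ =>
          Q₁ (i : ZMod T) * (Q₂ (i : ZMod T) *
            (fockLift (S ((i : ZMod T) - 1)) * Xf (i : ZMod T) * fockLift (S (i : ZMod T))⁻¹))).prod) s s =
      ∑ s : Finset ι, (-1 : ℂ) ^ s.card *
        (((List.range T).map fun i : ℕ =>
          Q₁' (i : ZMod T) * (Q₂' (i : ZMod T) * Xf (i : ZMod T))).prod) s s := by
  have hL : (fun i : ℕ => Q₁ (i : ZMod T) * (Q₂ (i : ZMod T) *
      (fockLift (S ((i : ZMod T) - 1)) * Xf (i : ZMod T) * fockLift (S (i : ZMod T))⁻¹))) =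
      fun i : ℕ => Q₁ (i : ZMod T) * Q₂ (i : ZMod T) * fockLift (S ((i : ZMod T) - 1)) *
        Xf (i : ZMod T) * fockLift (S (i : ZMod T))⁻¹ := by
    funext i
    simp only [Matrix.mul_assoc]
  have hR : (fun i : ℕ => Q₁' (i : ZMod T) * (Q₂' (i : ZMod T) * Xf (i : ZMod T))) =
      fun i : ℕ => fockLift (S ((i : ZMod T) - 1))⁻¹ * (Q₁ (i : ZMod T) * Q₂ (i : ZMod T)) *
        fockLift (S ((i : ZMod T) - 1)) * Xf (i : ZMod T) := by
    funext i
    rw [← h₁, ← h₂]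
    simp only [Matrix.mul_assoc]
    rw [← Matrix.mul_assoc (fockLift (S _)) (fockLift (S _)⁻¹), fockLift_mul_inv (hS _),
      Matrix.one_mul]
  rw [hL, hR]
  exact StubSupertraceUndressInsert.supertrace_undress_insert T S (fun t => Q₁ t * Q₂ t) Xf hS

/-- **Undressing two insertions at once (one-particle data → Fock level).**  If the one-step
matrices factor as `N_t = S_{t−1} (V X_t Vᵢ) Sᵢ_t` with `S_t Sᵢ_t = 1`, `V Vᵢ = 1` (temporal
transporters `S_t`, a constant similarity `V`), and `Sᵢ_{t_k−1} Z_k S_{t_k−1} = K_k`, then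
`STr ∏_{i<T} 𝒥¹_i 𝒥²_i Γ(reindex N_i) = STr ∏_{i<T} 𝒦¹_i 𝒦²_i Γ(reindex X_i)` for
`𝒥ᵏ_{t_k} = dΓ(reindex Z_k) − c_k·1`, `𝒦ᵏ_{t_k} = dΓ(reindex (Vᵢ K_k V)) − c_k·1` (`1` off the slices):
`supertrace_undress_insert₂` with `S̃_t = reindex (S_t V)` and `Γ(S̃ᵢ)(dΓ(Z) − c)Γ(S̃) = dΓ(S̃ᵢ Z S̃) − c`
(`StubWilsonChainUndressInsertion.fockLift_conj_dGamma_sub_smul`). [cite: Luscher1977, pp. 283–292] -/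
theorem undress_two (T : ℕ) (e : m ≃ n) (t₁ t₂ : ZMod T) (S Si X Nm : ZMod T → Matrix m m ℂ)
    (V Vi Z₁ K₁ Z₂ K₂ : Matrix m m ℂ) (c₁ c₂ : ℂ) (hSS : ∀ t, S t * Si t = 1) (hVVi : V * Vi = 1)
    (hN : ∀ t, Nm t = S (t - 1) * (V * X t * Vi) * Si t)
    (hZ₁ : Si (t₁ - 1) * Z₁ * S (t₁ - 1) = K₁) (hZ₂ : Si (t₂ - 1) * Z₂ * S (t₂ - 1) = K₂) :
    ∑ s : Finset n, (-1 : ℂ) ^ s.card *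
        (((List.range T).map fun i : ℕ =>
          (if (i : ZMod T) = t₁ then dGamma (Matrix.reindex e e Z₁) - c₁ • (1 : Matrix (Finset n) (Finset n) ℂ) else 1) *
            ((if (i : ZMod T) = t₂ then dGamma (Matrix.reindex e e Z₂) - c₂ • (1 : Matrix (Finset n) (Finset n) ℂ) else 1) *
              fockLift (Matrix.reindex e e (Nm (i : ZMod T))))).prod) s s =
      ∑ s : Finset n, (-1 : ℂ) ^ s.card *
        (((List.range T).map fun i : ℕ =>
          (if (i : ZMod T) = t₁ then
              dGamma (Matrix.reindex e e (Vi * K₁ * V)) - c₁ • (1 : Matrix (Finset n) (Finset n) ℂ) else 1) *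
            ((if (i : ZMod T) = t₂ then
                dGamma (Matrix.reindex e e (Vi * K₂ * V)) - c₂ • (1 : Matrix (Finset n) (Finset n) ℂ) else 1) *
              fockLift (Matrix.reindex e e (X (i : ZMod T))))).prod) s s := by
  -- the combined transporters `S̃_t = S_t V`, `S̃_t⁻¹ = Vᵢ Sᵢ_t`, at the Fock index
  have h1 : ∀ t, Matrix.reindex e e (S t * V) * Matrix.reindex e e (Vi * Si t) = 1 := fun t => by
    rw [← reindex_mul_reindex, Matrix.mul_assoc, ← Matrix.mul_assoc V, hVVi, Matrix.one_mul, hSS,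
      StubWilsonChainUndressInsertion.reindex_one]
  have hdet : ∀ t, IsUnit (Matrix.reindex e e (S t * V)).det := fun t => Matrix.isUnit_det_of_right_inverse (h1 t)
  have hinv : ∀ t, (Matrix.reindex e e (S t * V))⁻¹ = Matrix.reindex e e (Vi * Si t) := fun t =>
    Matrix.inv_eq_right_inv (h1 t)
  have h2 : ∀ t, Matrix.reindex e e (Vi * Si t) * Matrix.reindex e e (S t * V) = 1 := fun t => by
    rw [← hinv]
    exact Matrix.nonsing_inv_mul _ (hdet t)
  -- the conjugated insertions
  have hQ : ∀ (t₀ : ZMod T) (Z K : Matrix m m ℂ) (c : ℂ), Si (t₀ - 1) * Z * S (t₀ - 1) = K →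
      ∀ t : ZMod T, fockLift (Matrix.reindex e e (S (t - 1) * V))⁻¹ *
          (if t = t₀ then dGamma (Matrix.reindex e e Z) - c • (1 : Matrix (Finset n) (Finset n) ℂ) else 1) *
          fockLift (Matrix.reindex e e (S (t - 1) * V)) =
        if t = t₀ then dGamma (Matrix.reindex e e (Vi * K * V)) - c • (1 : Matrix (Finset n) (Finset n) ℂ) else 1 := by
    intro t₀ Z K c hZ t
    rw [hinv]
    by_cases ht : t = t₀
    · rw [if_pos ht, if_pos ht, StubWilsonChainUndressInsertion.fockLift_conj_dGamma_sub_smul (h2 _),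
        ← reindex_mul_reindex, ← reindex_mul_reindex, ht, ← hZ]
      simp only [Matrix.mul_assoc]
    · rw [if_neg ht, if_neg ht, Matrix.mul_one, ← fockLift_mul, h2, fockLift_one]
  -- factorising the dressed one-step operators
  have hfac : ∀ i : ℕ, fockLift (Matrix.reindex e e (Nm (i : ZMod T))) =
      fockLift (Matrix.reindex e e (S ((i : ZMod T) - 1) * V)) * fockLift (Matrix.reindex e e (X (i : ZMod T))) *
        fockLift (Matrix.reindex e e (S (i : ZMod T) * V))⁻¹ := fun i => by
    rw [hinv, ← fockLift_mul, ← fockLift_mul, ← reindex_mul_reindex, ← reindex_mul_reindex, hN]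
    simp only [Matrix.mul_assoc]
  simp only [hfac]
  have key := supertrace_undress_insert₂ T (fun t => Matrix.reindex e e (S t * V)) _ _ _ _
    (fun t => fockLift (Matrix.reindex e e (X t))) hdet (hQ t₁ Z₁ K₁ c₁ hZ₁) (hQ t₂ Z₂ K₂ c₂ hZ₂)
  exact key

end Undress

/-- **Distributing the Dirac-sea scalars with two slot insertions**:
`(∏_i c_i) · STr ∏_i Q¹_i Q²_i (Y_i Z_i) = STr ∏_i Q¹_i Q²_i ((c_i • Y_i) Z_i)`. [folklore] -/
theorem supertrace_prod_smul₂ {ι : Type*} [Fintype ι] [DecidableEq ι] (c : ℕ → ℂ)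
    (Q₁ Q₂ Y Z : ℕ → Matrix (Finset ι) (Finset ι) ℂ) (l : List ℕ) :
    (l.map c).prod * ∑ S : Finset ι, (-1 : ℂ) ^ S.card *
        (l.map fun i => Q₁ i * (Q₂ i * (Y i * Z i))).prod S S =
      ∑ S : Finset ι, (-1 : ℂ) ^ S.card * (l.map fun i => Q₁ i * (Q₂ i * (c i • Y i * Z i))).prod S S := by
  have h := StubDetDiracMatrixSourceHasDerivAtSmit.supertrace_prod_smul c (fun i => Q₁ i * Q₂ i) Y Z l
  simp only [Matrix.mul_assoc] at h
  exact h

end StubDetDiracMatrixTwoSourcesSmit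

open StubDetDiracMatrixTwoSourcesSmit in
/-- **E2-b(2) (per background, Smit vocabulary): two sources at distinct slices, and the
two-bilinear Berezin identity.**  For an `SU(3)` gauge field `U` on `(ℤ/L)⁴`, masses `mq f > −1`,
slices `t₁ ≠ t₂` and source blocks `Jh₁, Jh₂` on the quark variables of these slices:
(a) `∂_{s₁}|₀ ∂_{s₂}|₀ det (D(U) − s₁ Jt t₁ Jh₁ − s₂ Jt t₂ Jh₂) = Σ_S (−1)^{#S} ⟨S| ∏_i 𝒦¹_i 𝒦²_i (T̂_F(U_i) Γ(G_{g_i})) |S⟩`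
with `𝒦ᵏ_{t_k} = ins (U_{t_k}) Jh_k` the link-free insertion of the one-source theorem and `𝒦ᵏ_i = 1`
otherwise; (b) `∫dψ̄dψ (ψ̄ Jt₂ ψ)(ψ̄ Jt₁ ψ) e^{−ψ̄D(U)ψ}` is `ε = (−1)^{n(n−1)/2+n}` times the same
supertrace (registered stub signature verbatim).  Assembly of γ0-multi, F4-a, the two-insertion
undressing `undress_two`, the `N_f`-flavour dictionary and the Berezin stub (module docstring).
[cite: Luscher1977, pp. 283–292] [cite: Smit2023, §6.5 (6.91)] -/
theorem stub_det_diracMatrix_two_sources_smit : ∀ (Nf L : ℕ) [NeZero L] (U : GaugeConfig 4 L (Matrix.specialUnitaryGroup (Fin 3) ℂ)) (mq : Fin Nf → ℝ), (∀ f, -1 < mq f) → ∀ (t₁ t₂ : ZMod L), t₁ ≠ t₂ → ∀ (Jh₁ Jh₂ : Matrix (SliceQuarkVar Nf L) (SliceQuarkVar Nf L) ℂ), let Jt : ZMod L → Matrix (SliceQuarkVar Nf L) (SliceQuarkVar Nf L) ℂ → Matrix (FermiIdx Nf L) (FermiIdx Nf L) ℂ := fun t J => Matrix.reindex quarkEquiv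 quarkEquiv (Matrix.of fun v w : QuarkVar Nf L => if v.2.1 0 = t ∧ w.2.1 0 = t then J (v.1, (Fin.tail v.2.1, v.2.2)) (w.1, (Fin.tail w.2.1, w.2.2)) else 0); let ins : GaugeConfig 3 L (Matrix.specialUnitaryGroup (Fin 3) ℂ) → Matrix (SliceQuarkVar Nf L) (SliceQuarkVar Nf L) ℂ → Matrix (Finset (SliceFermiIdx Nf L)) (Finset (SliceFermiIdx Nf L)) ℂ := fun V J => dGamma (Matrix.reindex sliceQuarkEquiv sliceQuarkEquiv (sliceKron (Nf := Nf) (S := L) 1 (gammaFive * euclideanGamma 0) * ((-sliceKron (Nf := Nf) (S := L) 1 timeProjPlus + sliceKron (Nf := Nf) (S := L) 1 timeProjPlus * (sliceKron (Nf := Nf) (S := L) 1 (euclideanGamma 0) * sliceDiracKinetic V) * sliceKron ((sliceMassHop V mq)⁻¹) 1 * sliceKron (Nf := Nf) (S := L) 1 timeProjMinus + sliceKron ((sliceMassHop V mq)⁻¹) 1 * sliceKron (Nf := Nf) (S := L) 1 timeProjMinus) * J * (sliceKron (Nf := Nf) (S := L) 1 timeProjMinus + sliceKron (Nf := Nf)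 (S := L) 1 timeProjPlus * (sliceKron (Nf := Nf) (S := L) 1 (euclideanGamma 0 * gammaFive) * (fermionSliceMatrix V mq)⁻¹ * sliceKron (Nf := Nf) (S := L) 1 (gammaFive * euclideanGamma 0)))) * sliceKron (Nf := Nf) (S := L) 1 (euclideanGamma 0 * gammaFive))) - (J * sliceKron ((sliceMassHop V mq)⁻¹) 1 * sliceKron (Nf := Nf) (S := L) 1 timeProjMinus).trace • (1 : Matrix (Finset (SliceFermiIdx Nf L)) (Finset (SliceFermiIdx Nf L)) ℂ); HasDerivAt (fun s₁ : ℝ => deriv (fun s₂ : ℝ => (diracMatrix U mq - (s₁ : ℂ) • Jt t₁ Jh₁ - (s₂ : ℂ) • Jt t₂ Jh₂).det) 0) (∑ S : Finset (SliceFermiIdx Nf L), (-1 : ℂ) ^ S.card * ((((List.range L).map fun i : ℕ => (if (i : ZMod L) = t₁ then ins (fun e : Edge 3 L => U ((Fin.cons t₁ e.1 : TorusSite 4 L), e.2.succ)) Jh₁ else 1) * ((if (i : ZMod L) = t₂ then ins (fun e : Edge 3 L => U ((Fin.cons t₂ e.1 : TorusSite 4 L), e.2.succ)) Jh₂ else 1)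 * (fermionSliceOp (fun e : Edge 3 L => U ((Fin.cons (i : ZMod L) e.1 : TorusSite 4 L), e.2.succ)) mq * fockGaugeAct (Nf := Nf) (fun y : TorusSite 3 L => U ((Fin.cons (i : ZMod L) y : TorusSite 4 L), 0))))).prod : Matrix (Finset (SliceFermiIdx Nf L)) (Finset (SliceFermiIdx Nf L)) ℂ) S S)) 0 ∧ fermiIntegral (quadratic ℂ (Jt t₂ Jh₂) * quadratic ℂ (Jt t₁ Jh₁) * fermiBoltzmann U mq) = (-1 : ℂ) ^ (Fintype.card (FermiIdx Nf L) * (Fintype.card (FermiIdx Nf L) - 1) / 2 + Fintype.card (FermiIdx Nf L)) * ∑ S : Finset (SliceFermiIdx Nf L), (-1 : ℂ) ^ S.card * ((((List.range L).map fun i : ℕ => (if (i : ZMod L) = t₁ then ins (fun e : Edge 3 L => U ((Fin.cons t₁ e.1 : TorusSite 4 L), e.2.succ)) Jh₁ else 1) * ((if (i : ZMod L) = t₂ then ins (fun e : Edge 3 L => U ((Fin.cons t₂ e.1 : TorusSite 4 L), e.2.succ)) Jh₂ else 1) * (fermionSliceOp (fun e : Edge 3 L => U ((Fin.cons (i : ZMod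 L) e.1 : TorusSite 4 L), e.2.succ)) mq * fockGaugeAct (Nf := Nf) (fun y : TorusSite 3 L => U ((Fin.cons (i : ZMod L) y : TorusSite 4 L), 0))))).prod : Matrix (Finset (SliceFermiIdx Nf L)) (Finset (SliceFermiIdx Nf L)) ℂ) S S) := by
  intro Nf L _ U mq hm t₁ t₂ h12 Jh₁ Jh₂ Jt ins
  /- (0) Notation: `e_Nf = eA.symm`, slice data `U_t`, `g_t`, the chain data of γ0, `B̂_t`, `V = 1 ⊗ γ₄γ₅`, `Vᵢ`. -/
  set eA := Equiv.prodAssoc (Fin Nf) (TorusSite 3 L) (Fin 3 × Fin 4)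
  set Us : ZMod L → GaugeConfig 3 L (Matrix.specialUnitaryGroup (Fin 3) ℂ) := fun t e => U ((Fin.cons t e.1 : TorusSite 4 L), e.2.succ)
  set gs : ZMod L → TorusSite 3 L → Matrix.specialUnitaryGroup (Fin 3) ℂ := fun t y => U ((Fin.cons t y : TorusSite 4 L), 0)
  set Pp := Matrix.of fun a b : (Fin Nf × TorusSite 3 L) × Fin 3 × Fin 4 =>
    if a.1 = b.1 ∧ a.2.1 = b.2.1 then ((1 / 2 : ℂ) • (1 + euclideanGamma 0)) a.2.2 b.2.2 else 0 with hPp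
  set Pm := Matrix.of fun a b : (Fin Nf × TorusSite 3 L) × Fin 3 × Fin 4 =>
    if a.1 = b.1 ∧ a.2.1 = b.2.1 then ((1 / 2 : ℂ) • (1 - euclideanGamma 0)) a.2.2 b.2.2 else 0 with hPm
  set W := fun t : ZMod L => Matrix.of fun a b : (Fin Nf × TorusSite 3 L) × Fin 3 × Fin 4 =>
    if a.1 = b.1 ∧ a.2.2 = b.2.2 then fundamentalRep (Fin 3) (U ((Fin.cons t a.1.2 : TorusSite 4 L), 0)) a.2.1 b.2.1 else 0
  set W' := fun t : ZMod L => Matrix.of fun a b : (Fin Nf × TorusSite 3 L) × Fin 3 × Fin 4 =>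
    if a.1 = b.1 ∧ a.2.2 = b.2.2 then fundamentalRep (Fin 3) (U ((Fin.cons t a.1.2 : TorusSite 4 L), 0))⁻¹ a.2.1 b.2.1 else 0
  set A := fun t : ZMod L => Matrix.of fun a b : (Fin Nf × TorusSite 3 L) × Fin 3 × Fin 4 =>
    if a.1.1 = b.1.1 then
      ((if a = b then ((mq a.1.1 + 4 * 1 : ℝ) : ℂ) else 0) -
        (1 / 2 : ℂ) * ∑ j : Fin 3,
          ((if b.1.2 = Literature.MathematicalPhysics.QuantumFieldTheory.Site.shift a.1.2 j then
              (((1 : ℝ) : ℂ) • (1 : Matrix (Fin 4) (Fin 4) ℂ) - euclideanGamma j.succ) a.2.2 b.2.2 *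
                fundamentalRep (Fin 3) (U ((Fin.cons t a.1.2 : TorusSite 4 L), j.succ)) a.2.1 b.2.1 else 0) +
            (if a.1.2 = Literature.MathematicalPhysics.QuantumFieldTheory.Site.shift b.1.2 j then
              (((1 : ℝ) : ℂ) • (1 : Matrix (Fin 4) (Fin 4) ℂ) + euclideanGamma j.succ) a.2.2 b.2.2 *
                fundamentalRep (Fin 3) (U ((Fin.cons t b.1.2 : TorusSite 4 L), j.succ))⁻¹ a.2.1 b.2.1 else 0)))
      else 0
  set Bh := fun t : ZMod L => Matrix.reindex eA.symm eA.symm (sliceKron (sliceMassHop (Us t) mq) 1)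
  set V : Matrix (SliceQuarkVar Nf L) (SliceQuarkVar Nf L) ℂ := sliceKron 1 (euclideanGamma 0 * gammaFive)
  set Vi : Matrix (SliceQuarkVar Nf L) (SliceQuarkVar Nf L) ℂ := sliceKron 1 (gammaFive * euclideanGamma 0)
  /- (1) γ0: the chain hypotheses (transporters commute with `P±`, are mutually inverse). -/
  obtain ⟨-, hWPp, hWPm, hW'Pp, hW'Pm, hW'W, hWW'⟩ := stub_diracMatrix_source_timeSlice Nf L U mq t₁ 0 0
  /- (2) the `N_f`-flavour dictionary (W2-3a) and the dressed cores / prefactors (W2-3b). -/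
  have hdict := fun t => stub_flavourChain_slice_dictionary Nf L U mq t
  have hdPp : Pp = Matrix.reindex eA.symm eA.symm (sliceKron (Nf := Nf) (S := L) 1 timeProjPlus) := (hdict t₁).1
  have hdPm : Pm = Matrix.reindex eA.symm eA.symm (sliceKron (Nf := Nf) (S := L) 1 timeProjMinus) := (hdict t₁).2.1
  have hdW : ∀ t, W t = Matrix.reindex eA.symm eA.symm (sliceGaugeRot (Nf := Nf) (gs t)) := fun t => (hdict t).2.2.1
  have hAB : ∀ t, A t - Bh t = Matrix.reindex eA.symm eA.symm
      (sliceKron (Nf := Nf) (S := L) 1 (euclideanGamma 0) * sliceDiracKinetic (Us t)) := fun t => (hdict t).2.2.2.1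
  have hBP : ∀ t, Bh t * Pp = Pp * Bh t := fun t => (hdict t).2.2.2.2.1
  have hBQ : ∀ t, Bh t * Pm = Pm * Bh t := fun t => (hdict t).2.2.2.2.2.1
  have hPCP : ∀ t, Pp * (A t - Bh t) * Pp = 0 := fun t => (hdict t).2.2.2.2.2.2.1
  have hQCQ : ∀ t, Pm * (A t - Bh t) * Pm = 0 := fun t => (hdict t).2.2.2.2.2.2.2.1
  have hBhdet : ∀ t, IsUnit (Bh t).det := fun t => ((hdict t).2.2.2.2.2.2.2.2 hm).1
  have hBhinv : ∀ t, (Bh t)⁻¹ = Matrix.reindex eA.symm eA.symm (sliceKron ((sliceMassHop (Us t) mq)⁻¹) 1) :=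
    fun t => ((hdict t).2.2.2.2.2.2.2.2 hm).2
  have hcore := fun t => stub_flavourChain_dressedCore Nf L U mq hm t
  have hM' : ∀ t, (1 + Pp * (A t - Bh t) * Pm) * (Bh t * Pp + (Bh t)⁻¹ * Pm) * (1 - Pm * (A t - Bh t) * Pp) =
      Matrix.reindex eA.symm eA.symm (V * fermionSliceMatrix (Us t) mq * Vi) := fun t => (hcore t).1
  have hMi : ∀ t, (1 + Pm * (A t - Bh t) * Pp) * ((Bh t)⁻¹ * Pp + Bh t * Pm) * (1 - Pp * (A t - Bh t) * Pm) =
      Matrix.reindex eA.symm eA.symm (V * (fermionSliceMatrix (Us t) mq)⁻¹ * Vi) := fun t => (hcore t).2.1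
  have hdetE : ∀ t, (A t * Pm - Pp * W' (t - 1)).det = (sliceMassHop (Us t) mq).det ^ 2 := fun t => (hcore t).2.2.1
  have hE : ∀ t, IsUnit (A t * Pm - Pp * W' (t - 1)).det := fun t => (hcore t).2.2.2
  /- (3) projection algebra; invertibility of `F_t = A_t P⁺ − P⁻ W_t` (β1, conjunct 3, via `det`). -/
  have h1 : Pp + Pm = 1 := liftProjPlus_add_liftProjMinus (Fin Nf × TorusSite 3 L) 3
  have hPQ : Pp * Pm = 0 := liftProjPlus_mul_liftProjMinus (Fin Nf × TorusSite 3 L) 3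
  have hQP : Pm * Pp = 0 := liftProjMinus_mul_liftProjPlus (Fin Nf × TorusSite 3 L) 3
  have hPP : Pp * Pp = Pp := StubWilsonChainUndressInsertion.mul_self_of_add_eq_one h1 hPQ
  have hQQ : Pm * Pm = Pm := StubWilsonChainUndressInsertion.mul_self_of_add_eq_one' h1 hQP
  have hF : ∀ t, IsUnit (A t * Pp - Pm * W t).det := fun t => by
    obtain ⟨-, -, h3, -⟩ := stub_chainBlock_insertion_algebra _ Pp Pm (Bh t) (Bh t)⁻¹ (A t - Bh t)
      (W (t - 1)) (W' (t - 1)) (W t) (W' t) 0 h1 hPP hQQ hPQ hQP (Matrix.mul_nonsing_inv _ (hBhdet t))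
      (Matrix.nonsing_inv_mul _ (hBhdet t)) (hBP t) (hBQ t) (hPCP t) (hQCQ t) (hWPp _) (hWPm _)
      (hW'Pp _) (hW'Pm _) (hWPp _) (hWPm _) (hW'Pp _) (hW'Pm _) (hW'W _) (hWW' _) (hW'W _) (hWW' _)
    rw [add_sub_cancel] at h3
    have hd := congrArg Matrix.det h3
    rw [Matrix.det_mul, Matrix.det_mul, Matrix.det_one] at hd
    exact isUnit_of_mul_isUnit_right (IsUnit.of_mul_eq_one _ hd)
  /- (4) undressing data: `V Vᵢ = 1`, the factorisation `N_t = S_{t−1} (V′ · reindex (M_F(U_t) G_t) · Vᵢ′) Sᵢ_t`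
    (F2's `neg_inv_mul_eq_dressed`, the dictionary, `G Vᵢ = Vᵢ G`), and the link-free insertions
    with the trace identity (F2's `insertion_undress`, the dictionary). -/
  have hVVi : V * Vi = 1 := SliceGammaConjugation.gamma05_sliceKron_mul_gamma50_sliceKron
  have hrV : Matrix.reindex eA.symm eA.symm V * Matrix.reindex eA.symm eA.symm Vi = 1 := by
    rw [← reindex_mul_reindex, hVVi, StubWilsonChainUndressInsertion.reindex_one]
  have hMW : ∀ t, Matrix.reindex eA.symm eA.symm (V * fermionSliceMatrix (Us t) mq * Vi) * W t =
      Matrix.reindex eA.symm eA.symm V * Matrix.reindex eA.symm eA.symm (fermionSliceMatrix (Us t) mq * sliceGaugeRot (gs t)) *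
        Matrix.reindex eA.symm eA.symm Vi := fun t => by
    have hX : V * fermionSliceMatrix (Us t) mq * Vi * sliceGaugeRot (gs t) =
        V * (fermionSliceMatrix (Us t) mq * sliceGaugeRot (gs t)) * Vi := by
      rw [Matrix.mul_assoc (V * _) Vi, sliceKron_one_mul_sliceGaugeRot_comm Nf L _ (gs t),
        ← Matrix.mul_assoc, Matrix.mul_assoc V]
    rw [hdW t, ← reindex_mul_reindex, hX, reindex_mul_reindex, reindex_mul_reindex]
  have hN : ∀ t, -((A t * Pm - Pp * W' (t - 1))⁻¹ * (A t * Pp - Pm * W t)) =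
      (W (t - 1) * Pp + Pm) * (Matrix.reindex eA.symm eA.symm V *
        Matrix.reindex eA.symm eA.symm (fermionSliceMatrix (Us t) mq * sliceGaugeRot (gs t)) *
        Matrix.reindex eA.symm eA.symm Vi) * (W' t * Pp + Pm) := fun t => by
    have h := StubWilsonChainUndressInsertion.neg_inv_mul_eq_dressed Pp Pm (Bh t) (A t - Bh t)
      (W (t - 1)) (W' (t - 1)) (W t) (W' t) h1 hPP hQQ hPQ hQP (hBP t) (hBQ t) (hPCP t) (hQCQ t)
      (hWPm _) (hW'Pp _) (hW'W _) (hWPm t) (hWW' t) (hBhdet t)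
    rwa [add_sub_cancel, hM', hMW] at h
  have htr : ∀ X : Matrix (SliceQuarkVar Nf L) (SliceQuarkVar Nf L) ℂ, (Matrix.reindex eA.symm eA.symm X).trace = X.trace :=
    fun X => by simpa only [Matrix.trace, Matrix.diag_apply, Matrix.reindex_apply, Matrix.submatrix_apply] using
      eA.symm.symm.sum_comp (fun i => X i i)
  have hZ : ∀ (t : ZMod L) (J : Matrix (SliceQuarkVar Nf L) (SliceQuarkVar Nf L) ℂ),
      (W' (t - 1) * Pp + Pm) * ((A t * Pm - Pp * W' (t - 1))⁻¹ * Matrix.reindex eA.symm eA.symm J *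
          (Pm - Pp * (A t * Pp - Pm * W t)⁻¹ * (A t * Pm - Pp * W' (t - 1)))) * (W (t - 1) * Pp + Pm) =
        Matrix.reindex eA.symm eA.symm
          ((-sliceKron (Nf := Nf) (S := L) 1 timeProjPlus +
                sliceKron (Nf := Nf) (S := L) 1 timeProjPlus *
                  (sliceKron (Nf := Nf) (S := L) 1 (euclideanGamma 0) * sliceDiracKinetic (Us t)) *
                  sliceKron ((sliceMassHop (Us t) mq)⁻¹) 1 * sliceKron (Nf := Nf) (S := L) 1 timeProjMinus +
              sliceKron ((sliceMassHop (Us t) mq)⁻¹) 1 * sliceKron (Nf := Nf) (S := L) 1 timeProjMinus) * J *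
            (sliceKron (Nf := Nf) (S := L) 1 timeProjMinus +
              sliceKron (Nf := Nf) (S := L) 1 timeProjPlus * (V * (fermionSliceMatrix (Us t) mq)⁻¹ * Vi))) ∧
      ((A t * Pm - Pp * W' (t - 1))⁻¹ * Matrix.reindex eA.symm eA.symm J * Pm).trace =
        (J * sliceKron ((sliceMassHop (Us t) mq)⁻¹) 1 * sliceKron (Nf := Nf) (S := L) 1 timeProjMinus).trace := by
    intro t J
    obtain ⟨hK, hc⟩ := StubWilsonChainUndressInsertion.insertion_undress Pp Pm (Bh t) (A t - Bh t)
      (W (t - 1)) (W' (t - 1)) (W t) (W' t) (Matrix.reindex eA.symm eA.symm J) h1 hPP hQQ hPQ hQP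
      (hBP _) (hBQ _) (hPCP _) (hQCQ _) (hWPp _) (hWPm _) (hW'Pp _) (hW'Pm _) (hWPp _) (hWPm _)
      (hW'Pp _) (hW'Pm _) (hW'W _) (hWW' _) (hW'W _) (hWW' _) (hBhdet _)
    rw [add_sub_cancel] at hK hc
    refine ⟨hK.trans ?_, hc.trans ?_⟩
    · rw [hMi, hAB, hBhinv, hdPp, hdPm]
      simp only [← Matrix.coe_reindexAlgEquiv ℂ ℂ eA.symm, ← map_mul, ← map_add, ← map_neg]
    · rw [hBhinv, hdPm, ← reindex_mul_reindex, ← reindex_mul_reindex, htr]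
  /- (5) F4-a: the abstract two-source derivative; then both insertions are undressed at once, the
    reindexings collapse, the traces are identified, `Γ(M_F G) = Γ(M_F) Γ(G)`, and the scalars
    `∏ det E_t = ∏_i det Â_i²` are pushed onto `T̂_F(U_i) = det Â_i² · Γ(M_F(U_i))`. -/
  have hder := stub_projChain_det_two_sources L (Fin Nf × TorusSite 3 L) 3 (Fintype.card (SliceQuarkVar Nf L))
    (eA.trans sliceQuarkEquiv) A W W' t₁ t₂ (Matrix.reindex eA.symm eA.symm Jh₁)
    (Matrix.reindex eA.symm eA.symm Jh₂) hWPp hWPm hW'Pp hW'Pm hE (hF t₁) (hF t₂) h12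
  rw [← hPp, ← hPm] at hder
  have hpref : (∏ t, (A t * Pm - Pp * W' (t - 1)).det) =
      ((List.range L).map fun i : ℕ => (sliceMassHop (Us (i : ZMod L)) mq).det ^ 2).prod :=
    (Finset.prod_congr rfl fun t _ => hdetE t).trans (SupertraceTransferForm.prod_univ_zmod_eq L _)
  have hsplit : ∀ i : ℕ, fockLift (Matrix.reindex sliceQuarkEquiv sliceQuarkEquiv
      (fermionSliceMatrix (Us i) mq * sliceGaugeRot (Nf := Nf) (gs i))) =
        fockLift (Matrix.reindex sliceQuarkEquiv sliceQuarkEquiv (fermionSliceMatrix (Us i) mq)) *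
      fockLift (Matrix.reindex sliceQuarkEquiv sliceQuarkEquiv (sliceGaugeRot (Nf := Nf) (gs i))) := fun i => by
    rw [reindex_mul_reindex, fockLift_mul]
  rw [undress_two L (eA.trans sliceQuarkEquiv) t₁ t₂ (fun t => W t * Pp + Pm) (fun t => W' t * Pp + Pm)
    (fun t => Matrix.reindex eA.symm eA.symm (fermionSliceMatrix (Us t) mq * sliceGaugeRot (gs t))) _
    (Matrix.reindex eA.symm eA.symm V) (Matrix.reindex eA.symm eA.symm Vi) _ _ _ _ _ _
    (fun t => StubChainBlockInsertionAlgebra.left_pair_mul Pp Pm (W t) (W' t) h1 hPP hQQ hPQ hQP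
      (hWW' t) (hW'Pp t)) hrV hN (hZ t₁ Jh₁).1 (hZ t₂ Jh₂).1, hpref] at hder
  conv at hder =>
    arg 2
    simp only [← reindex_mul_reindex, StubDetDiracMatrixSourceHasDerivAtSmit.reindex_trans_reindex_symm,
      (hZ t₁ Jh₁).2, (hZ t₂ Jh₂).2, hsplit]
    rw [supertrace_prod_smul₂]
  /- (6) the function: γ0-multi with `c = s₁δ_{t₁} + s₂δ_{t₂}` (chain side slice by slice, torus side entrywise). -/
  have hγm : ∀ s₁ s₂ : ℝ, (diracMatrix U mq - (s₁ : ℂ) • Jt t₁ Jh₁ - (s₂ : ℂ) • Jt t₂ Jh₂).det =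
      (Matrix.of fun p q : ZMod L × ((Fin Nf × TorusSite 3 L) × Fin 3 × Fin 4) =>
        (if q.1 = p.1 then
            (A p.1 - (if p.1 = t₁ then (s₁ : ℂ) • Matrix.reindex eA.symm eA.symm Jh₁ else 0) -
              (if p.1 = t₂ then (s₂ : ℂ) • Matrix.reindex eA.symm eA.symm Jh₂ else 0)) p.2 q.2 else 0) -
          (if q.1 = p.1 + 1 then (Pm * W p.1) p.2 q.2 else 0) -
          (if p.1 = q.1 + 1 then (Pp * W' q.1) p.2 q.2 else 0)).det := by
    intro s₁ s₂
    have h := stub_diracMatrix_multiSource_timeSlice Nf L U mq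
      (fun t => if t = t₁ then (s₁ : ℂ) else if t = t₂ then (s₂ : ℂ) else 0)
      (fun t => if t = t₁ then Jh₁ else if t = t₂ then Jh₂ else 0)
    refold_let eA Pp Pm W W' A at h
    have hsl : ∀ t : ZMod L, A t - (if t = t₁ then (s₁ : ℂ) else if t = t₂ then (s₂ : ℂ) else 0) •
        Matrix.reindex eA.symm eA.symm (if t = t₁ then Jh₁ else if t = t₂ then Jh₂ else 0) =
        A t - (if t = t₁ then (s₁ : ℂ) • Matrix.reindex eA.symm eA.symm Jh₁ else 0) -
          (if t = t₂ then (s₂ : ℂ) • Matrix.reindex eA.symm eA.symm Jh₂ else 0) := by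
      intro t
      by_cases ht₁ : t = t₁
      · simp [ht₁, h12]
      by_cases ht₂ : t = t₂
      · simp [ht₂, h12.symm]
      simp [ht₁, ht₂]
    simp only [hsl] at h
    rw [sub_sub]
    convert h using 3
    ext v w
    simp +zetaDelta only [Matrix.add_apply, Matrix.smul_apply, smul_eq_mul, Matrix.reindex_apply,
      Matrix.submatrix_apply, Matrix.of_apply]
    generalize (quarkEquiv.symm v).2.1 0 = a
    generalize (quarkEquiv.symm w).2.1 0 = b
    by_cases hab : a = b
    · subst hab
      by_cases ha₁ : a = t₁
      · simp [ha₁, h12]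
      by_cases ha₂ : a = t₂
      · simp [ha₂, h12.symm]
      simp [ha₁, ha₂]
    · have e : ∀ t : ZMod L, ¬(a = t ∧ b = t) := fun t ht => hab (ht.1.trans ht.2.symm)
      simp [e, hab]
  /- (7) assembly: (a), and (b) from (a) and the Berezin stub (conjunct 3) by uniqueness. -/
  refine ⟨?hda, deriv_two_unique ?hda (stub_fermiIntegral_sources_det Nf L U mq _ _).2.2⟩
  simp only [hγm]
  unfold fermionSliceOp fockGaugeAct
  exact hder

end Summit.QuantumFields.QCD.Cruxes.RobustYangMillsHandover.PinTheInfimum
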